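import Mathlib
import HarnessLib
import Summits.ResolutionOfSingularities.ResolutionOfSingularities.Theorems.WildQuotientsWildQuotientResolutionS1aGraphTailPoint
import Summits.ResolutionOfSingularities.ResolutionOfSingularities.Theorems.WildQuotientsWildQuotientResolutionS1aGraphRootDataGen
import Summits.ResolutionOfSingularities.ResolutionOfSingularities.Theorems.WildQuotientsWildQuotientResolutionS1aGraphTailMember
import Summits.ResolutionOfSingularities.ResolutionOfSingularities.Theorems.WildQuotientsWildQuotientResolutionS1aGraphTailFix
import Summits.ResolutionOfSingularities.ResolutionOfSingularities.Theorems.WildQuotientsWildQuotientResolutionS1aGraphTailDeriv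
import Summits.ResolutionOfSingularities.ResolutionOfSingularities.Theorems.WildQuotientsWildQuotientResolutionS1aSectionGlueKill
import Summits.ResolutionOfSingularities.ResolutionOfSingularities.Theorems.WildQuotientsWildQuotientResolutionS1aMultiRootAtlas
import Summits.ResolutionOfSingularities.ResolutionOfSingularities.Theorems.WildQuotientsWildQuotientResolutionS1aMultiRootGlue
import Summits.ResolutionOfSingularities.ResolutionOfSingularities.Theorems.WildQuotientsWildQuotientResolutionS1aTmonoKillsIn
import Summits.ResolutionOfSingularities.ResolutionOfSingularities.Theorems.WildQuotientsWildQuotientResolutionS1aGraphTailAux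

/-!
# S1a — ★★★ R4e-rational `graphTail_killsIn_two`: the GRAPH TAIL `x₃ ↦ x₃ + (x₂ − g(x₁))` with `k`-rational critical points is a TWO-SHOT kill

[OURS · L1 W4.5c · lead-1 g17; plan-1 RULINGS R-F15p/q/r/s, SPEC of record `Cruxes/CyclicQuotientFourfolds/Lines/s1a_logminvertex-R4e-SPEC.md`. MOVE 1 = the
multi-support root: per critical point `αᵢ` (multiplicity `mᵢ`, local factorisation `g(X+αᵢ) − g(αᵢ) = X^{mᵢ+1}wᵢ`) the point root `(x₀ : mᵢ+2, x₁−αᵢ : 1, x₂−g(αᵢ) :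
mᵢ+1)` on the localised chart `Wᵢ = D(∏_{j≠i}N(x₁−αⱼ))` (✓`exists_graphTail_pointCentre`), Veronese-renormalised to a common degree and glued along DISJOINT supports
(✓`MultiRoot.isAdmissibleCentre_infRees_of_disjoint`); the carried formal locus lies in `⋃Wᵢ` (✓`fLocus_subset_iUnion_basicOpen_locPoly`); the move atlas
✓`exists_moveAtlas_of_nodes` with the ring data ✓`graphRoot_ringData'` kills the charts of `x₀` and of the tail norms. MOVE 2 = ONE glued principal centre, the strict
transform `S′` of `S = V(x₀, x₂ − g(x₁))`, read on the `r` charts `O′ᵢ₁` through the section-presented members ✓`exists_graphTail_memberChart` and killed by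
✓`killsIn_one_of_sectionCharts`] — NOT statements of the manuscript; counted 0; AI-level work, weaker than expert review. Crux stmt-ResolutionOfSingularities-17941
`CyclicQuotientFourfolds`, line `s1a-logminvertex` v13 (`stub_reachLowerInFX`).
-/

set_option linter.dupNamespace false

noncomputable section

open CategoryTheory Limits AlgebraicGeometry TopologicalSpace Topology Opposite MvPolynomial
open Literature.AlgebraicGeometry.Resolution Literature.AlgebraicGeometry.RelativeSpec
open scoped LaurentPolynomial
open Summit.ResolutionOfSingularities.ResolutionOfSingularities.Theorems.WildQuotientResolution.S1 Summit.ResolutionOfSingularities.ResolutionOfSingularities.Theorems.WildQuotientResolution.S1.NodeAtlas Summit.ResolutionOfSingularities.ResolutionOfSingularities.Theorems.WildQuotientResolution.S1.CoarseChart Summit.ResolutionOfSingularities.ResolutionOfSingularities.Theorems.WildQuotientResolution.S1.ProducerStep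
open Summit.ResolutionOfSingularities.ResolutionOfSingularities.Theorems.WildQuotientResolution.S1.NpFrame Summit.ResolutionOfSingularities.ResolutionOfSingularities.Theorems.WildQuotientResolution.S1.GoodCharts Summit.ResolutionOfSingularities.ResolutionOfSingularities.Theorems.WildQuotientResolution.S1.BlowupCharts Summit.ResolutionOfSingularities.ResolutionOfSingularities.Theorems.WildQuotientResolution.S1.KillableTransport
open Summit.ResolutionOfSingularities.ResolutionOfSingularities.Theorems.WildQuotientResolution.S1.KillCert Summit.ResolutionOfSingularities.ResolutionOfSingularities.Theorems.WildQuotientResolution.S1.ReesBigrading Summit.ResolutionOfSingularities.ResolutionOfSingularities.Theorems.WildQuotientResolution.S1.NodeTransport Summit.ResolutionOfSingularities.ResolutionOfSingularities.Theorems.WildQuotientResolution.S1.CobordantTransport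
open Summit.ResolutionOfSingularities.ResolutionOfSingularities.Theorems.WildQuotientResolution.BlowupExit Summit.ResolutionOfSingularities.ResolutionOfSingularities.Theorems.WildQuotientResolution.S1.KillGlue Summit.ResolutionOfSingularities.ResolutionOfSingularities.Theorems.WildQuotientResolution.S1.CentreGluing Summit.ResolutionOfSingularities.ResolutionOfSingularities.Theorems.WildQuotientResolution.S1.FreeModel
open Summit.ResolutionOfSingularities.ResolutionOfSingularities.Theorems.WildQuotientResolution.S1.ModelNode Summit.ResolutionOfSingularities.ResolutionOfSingularities.Theorems.WildQuotientResolution.S1.NodeAway Summit.ResolutionOfSingularities.ResolutionOfSingularities.Theorems.WildQuotientResolution.S1.NodeChartAway Summit.ResolutionOfSingularities.ResolutionOfSingularities.Theorems.WildQuotientResolution.S1.CentreAway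

namespace Summit.ResolutionOfSingularities.ResolutionOfSingularities.Theorems.WildQuotientResolution.S1.GameFrame.GModel

variable {p : ℕ} {X' X₁ : Scheme.{0}} {q : X' ⟶ X₁} {G : Type} [Group G] {ρ : G →* Aut X'} {g₀ : G}

set_option maxHeartbeats 16000000 in
set_option synthInstance.maxHeartbeats 400000 in
/-- ★★★ **`KillsIn 2` FOR THE INITIAL MODEL OF THE GRAPH TAIL `x₂ − g(x₁)` WITH `k`-RATIONAL CRITICAL POINTS** (R4 normal form `σ: x₁ ↦ x₁ + x₀, x₃ ↦ x₃ + (x₂ − g(x₁))`;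
`g′ = c·∏ⱼ(X − αⱼ)^{mⱼ}`, `α` injective, `0 < r`, local factorisations `g(X+αᵢ) − g(αᵢ) = X^{mᵢ+1}wᵢ`). See the module docstring.
[OURS · L1 W4.5c · R4e-rational; NOT a statement of the manuscript] -/
theorem graphTail_killsIn_two [Finite G] (hp : p.Prime) (hG : ∀ g : G, g ∈ Subgroup.zpowers g₀) (hg₀ : g₀ ^ p = 1)
    (hq : ∀ g : G, (ρ g).hom ≫ q = q) [IsIntegral X'] [IsLocallyNoetherian X'] [X'.IsSeparated] [IsAffine X']
    {k' : Type} [Field k'] (φ : X₁ ⟶ Spec (.of k')) [IsSeparated φ] [LocallyOfFiniteType φ] [IsFinite q]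
    {k : Type} [Field k] [Fact p.Prime] [CharP k p]
    (g : Polynomial k) {r : ℕ} (hr : 0 < r) (α : Fin r → k) (hα : Function.Injective α) (m : Fin r → ℕ) (c : k) (hc : c ≠ 0)
    (hg' : Polynomial.derivative g = Polynomial.C c * ∏ j, (Polynomial.X - Polynomial.C (α j)) ^ m j)
    (wloc : Fin r → Polynomial k) (hwloc : ∀ i, g.comp (Polynomial.X + Polynomial.C (α i)) - Polynomial.C (g.eval (α i)) = Polynomial.X ^ (m i + 1) * wloc i)
    (σ : (MvPolynomial (Fin 4) k) ≃+* (MvPolynomial (Fin 4) k)) (hC : ∀ a : k, σ (C a) = C a)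
    (h0 : σ (X 0) = X 0) (h1 : σ (X 1) = X 1 + X 0) (h2 : σ (X 2) = X 2) (h3 : σ (X 3) = X 3 + (X 2 - Polynomial.aeval (X 1 : (MvPolynomial (Fin 4) k)) g))
    (e : Γ(X', ⊤) ≃+* (MvPolynomial (Fin 4) k))
    (hστ : ∀ t : Γ(X', ⊤), e ((ρ g₀⁻¹).hom.appLE ⊤ ⊤ (by rw [Scheme.Hom.preimage_top]) t) = σ (e t))
    (h₀ : NodeAtlas p (⟨ρ, hq⟩ : ActionOver q G) g₀) :
    KillsIn 2 (GModel.initial (p := p) (g₀ := g₀) hq h₀) := by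
  classical
  haveI : NeZero p := ⟨hp.ne_zero⟩
  have hp1 : p ≠ 1 := hp.one_lt.ne'
  -- ### the root chart `O = X′`
  haveI : IsAffine (⊤ : X'.Opens) := isAffineOpen_top X'
  have hAff : IsAffineHom ((⊤ : X'.Opens).ι ≫ q) := inferInstance
  have hst : ∀ g : G, (ρ g).hom ⁻¹ᵁ (⊤ : X'.Opens) = ⊤ := fun g => Scheme.Hom.preimage_top _
  let O : (GModel.initial (p := p) (g₀ := g₀) hq h₀).act.StableAffineOpens := ⟨⊤, hst, hAff⟩
  have hO : IsAffineOpen O.1 := isAffineOpen_top X'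
  have hOuniv : ∀ u : (GModel.initial (p := p) (g₀ := g₀) hq h₀).V, u ∈ O.1 := fun _ => Set.mem_univ _
  haveI hsep₀ : (GModel.initial (p := p) (g₀ := g₀) hq h₀).V.IsSeparated := ‹X'.IsSeparated›
  obtain ⟨e₀, he₀⟩ : ∃ e₀ : Γ((GModel.initial (p := p) (g₀ := g₀) hq h₀).V, O.1) ≃+* (MvPolynomial (Fin 4) k), ∀ t, e₀ t = e t := ⟨e, fun _ => rfl⟩
  have hact : ∀ t : Γ((GModel.initial (p := p) (g₀ := g₀) hq h₀).V, O.1), actOEquiv (GModel.initial (p := p) (g₀ := g₀) hq h₀).act O g₀ t = e₀.symm (σ (e₀ t)) := fun t => e₀.injective (by rw [e₀.apply_symm_apply, he₀, he₀, ← hστ]; rfl)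
  have hσp : ∀ a : (MvPolynomial (Fin 4) k), (⇑σ)^[p] a = a := iterate_eq_self_of_chart (GModel.initial (p := p) (g₀ := g₀) hq h₀) O hg₀ e₀ σ hact
  have hcl : ∀ S : Set Γ((GModel.initial (p := p) (g₀ := g₀) hq h₀).V, O.1), IsClosed ((GModel.initial (p := p) (g₀ := g₀) hq h₀).V.zeroLocus (U := O.1) S ∩ (O.1 : Set (GModel.initial (p := p) (g₀ := g₀) hq h₀).V)) := fun S =>
    ((GModel.initial (p := p) (g₀ := g₀) hq h₀).V.zeroLocus_isClosed _).inter (by exact isClosed_univ)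
  -- ### per critical point: the recentred chart, the localised node `Wᵢ` and its admissible root
  have hpt := fun i => exists_graphTail_pointCentre hG (GModel.initial (p := p) (g₀ := g₀) hq h₀) O hO e₀ σ hC h0 h1 h2 g h3 hact hσp hcl α hα m wloc hwloc i
  choose hh hhh γ eI σI hσh hactI hrest using hpt
  have heI : ∀ i t, eI i t = γ i (e₀ t) := fun i => (hrest i).1
  have hγs0 : ∀ i, (γ i).symm (X 0) = X 0 := fun i => (hrest i).2.1.2.2.2.2.1
  have hγs1 : ∀ i, (γ i).symm (X 1) = X 1 - C (α i) := fun i => (hrest i).2.1.2.2.2.2.2.1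
  have hγs2 : ∀ i, (γ i).symm (X 2) = X 2 - C (g.eval (α i)) := fun i => (hrest i).2.1.2.2.2.2.2.2.1
  have hCI : ∀ i (a : k), σI i (C a) = C a := fun i => (hrest i).2.2.1.1
  have h0I : ∀ i, σI i (X 0) = X 0 := fun i => (hrest i).2.2.1.2.1
  have h1I : ∀ i, σI i (X 1) = X 1 + X 0 := fun i => (hrest i).2.2.1.2.2.1
  have h2I : ∀ i, σI i (X 2) = X 2 := fun i => (hrest i).2.2.1.2.2.2.1
  have h3I : ∀ i, σI i (X 3) = X 3 + (X 2 - X 1 ^ (m i + 1) * Polynomial.aeval (X 1 : MvPolynomial (Fin 4) k) (wloc i) : MvPolynomial (Fin 4) k) := fun i => (hrest i).2.2.1.2.2.2.2.1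
  have hσpI : ∀ i (a : (MvPolynomial (Fin 4) k)), (⇑(σI i))^[p] a = a := fun i => (hrest i).2.2.1.2.2.2.2.2
  have hnode := fun i => (hrest i).2.2.2
  choose 𝒜u gr eW hfull htame hσW hpinW hKex using hnode
  choose 𝒦 dI hdI hadm hchart hG𝒦 hfil hver hsupp using hKex
  letI : ∀ i, GradedRing (𝒜u i) := gr
  have hW1 : ∀ i, (basicOpenStable (GModel.initial (p := p) (g₀ := g₀) hq h₀).act O hO (actO_symm_eq_of_fixed hG (GModel.initial (p := p) (g₀ := g₀) hq h₀) O (eI i) (σI i) (hactI i) (hh i) (hσh i))).1 = (GModel.initial (p := p) (g₀ := g₀) hq h₀).V.basicOpen ((eI i).symm (hh i)) := fun i => rfl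
  have hWaff : ∀ i, IsAffineOpen (basicOpenStable (GModel.initial (p := p) (g₀ := g₀) hq h₀).act O hO (actO_symm_eq_of_fixed hG (GModel.initial (p := p) (g₀ := g₀) hq h₀) O (eI i) (σI i) (hactI i) (hh i) (hσh i))).1 := fun i => hO.basicOpen _
  have heIs : ∀ i (f : (MvPolynomial (Fin 4) k)), (eI i).symm f = e₀.symm ((γ i).symm f) := fun i f =>
    (eI i).injective (by rw [(eI i).apply_symm_apply, heI, e₀.apply_symm_apply]; exact ((γ i).apply_symm_apply f).symm)
  have hfA : ∀ i (l : Fin 3), (fun l => algebraMap (MvPolynomial (Fin 4) k) (Localization.Away (hh i)) (X ((![0, 1, 2] : Fin 3 → Fin 4) l))) l ∈ 𝒜u i ((fun _ => (0 : (Π j : Fin 0, ZMod ((![] : Fin 0 → ℕ) j)))) l) := fun i l => hfull i _ _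
  have hfull0 : ∀ i (x : (Localization.Away (hh i))), x ∈ 𝒜u i 0 := fun i x => hfull i _ _
  have hw0 : ∀ i, (![m i + 2, 1, m i + 1] : Fin 3 → ℕ) 0 = (![m i + 2, 1, m i + 1] : Fin 3 → ℕ) 1 + (m i + 1) := fun i => by change m i + 2 = 1 + (m i + 1); ring
  have hw : ∀ i (l : Fin 3), 0 < (![m i + 2, 1, m i + 1] : Fin 3 → ℕ) l := fun i l => by fin_cases l <;> simp
  have ht0 : ∀ i, (X 2 - X 1 ^ (m i + 1) * Polynomial.aeval (X 1 : MvPolynomial (Fin 4) k) (wloc i) : MvPolynomial (Fin 4) k) ∈ (weightedFiltration (fun l => (X ((![0, 1, 2] : Fin 3 → Fin 4) l) : (MvPolynomial (Fin 4) k))) (![m i + 2, 1, m i + 1] : Fin 3 → ℕ)).ideal (m i + 1) := fun i =>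
    GraphTail.graphTail_mem (m i) (wloc i)
  have ht : ∀ i, algebraMap (MvPolynomial (Fin 4) k) (Localization.Away (hh i)) (X 2 - X 1 ^ (m i + 1) * Polynomial.aeval (X 1 : MvPolynomial (Fin 4) k) (wloc i) : MvPolynomial (Fin 4) k) ∈ (weightedFiltration (fun l => algebraMap (MvPolynomial (Fin 4) k) (Localization.Away (hh i)) (X ((![0, 1, 2] : Fin 3 → Fin 4) l))) (![m i + 2, 1, m i + 1] : Fin 3 → ℕ)).ideal (m i + 1) := fun i => KillCert.QhAway.qhl_tail_mem (X 2 - X 1 ^ (m i + 1) * Polynomial.aeval (X 1 : MvPolynomial (Fin 4) k) (wloc i) : MvPolynomial (Fin 4) k) (![m i + 2, 1, m i + 1] : Fin 3 → ℕ) (m i + 1) (ht0 i) (hh i)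
  have hσJ : ∀ i (n : ℕ), ((weightedFiltration (fun l => algebraMap (MvPolynomial (Fin 4) k) (Localization.Away (hh i)) (X ((![0, 1, 2] : Fin 3 → Fin 4) l))) (![m i + 2, 1, m i + 1] : Fin 3 → ℕ)).ideal n).map ((sigmaAway (σI i) (hσh i)) : (Localization.Away (hh i)) →+* (Localization.Away (hh i))) ≤ (weightedFiltration (fun l => algebraMap (MvPolynomial (Fin 4) k) (Localization.Away (hh i)) (X ((![0, 1, 2] : Fin 3 → Fin 4) l))) (![m i + 2, 1, m i + 1] : Fin 3 → ℕ)).ideal n := fun i n =>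
    KillCert.QhAway.qhl_map_le (σI i) (hCI i) (h0I i) (h1I i) (h2I i) (X 2 - X 1 ^ (m i + 1) * Polynomial.aeval (X 1 : MvPolynomial (Fin 4) k) (wloc i) : MvPolynomial (Fin 4) k) (h3I i) (![m i + 2, 1, m i + 1] : Fin 3 → ℕ) (m i + 1) (hw0 i) (ht0 i) (hh i) (hσh i) n
  have hσpL : ∀ i (y : (Localization.Away (hh i))), (⇑(sigmaAway (σI i) (hσh i)))^[p] y = y := fun i y => KillCert.QhAway.qhl_iterate (σI i) (hh i) (hσh i) (hσpI i) y
  have hne : ∀ i, ∀ j ∈ Finset.univ.erase i, α i - α j ≠ 0 := fun i j hj h => Finset.ne_of_mem_erase hj (hα (sub_eq_zero.mp h)).symm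
  have hh0ev : ∀ i, MvPolynomial.eval (fun _ : Fin 4 => (0 : k)) (hh i) ≠ 0 := fun i => hhh i ▸ GraphTail.eval_locPoly_ne_zero _ _ (hne i) _ rfl rfl
  have hh0 : ∀ i, hh i ≠ 0 := fun i h => hh0ev i (by rw [h, map_zero])
  have hK1 : ∀ i, RingTheory.Sequence.IsRegular (Localization.Away (hh i)) (List.ofFn (fun l => algebraMap (MvPolynomial (Fin 4) k) (Localization.Away (hh i)) (X ((![0, 1, 2] : Fin 3 → Fin 4) l)))) := fun i =>
    KillCert.QhAway.qhl_isRegular (hh i) (fun _ => (0 : k)) rfl rfl rfl (hh0ev i)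
  have hK1' : ∀ i, IsRegularRing ((Localization.Away (hh i)) ⧸ Ideal.span (Set.range (fun l => algebraMap (MvPolynomial (Fin 4) k) (Localization.Away (hh i)) (X ((![0, 1, 2] : Fin 3 → Fin 4) l))))) := fun i => KillCert.QhAway.qhl_isRegularRing_quotient (hh i)
  -- ### the common Veronese degree `D = ∏ dᵢ`
  obtain ⟨D, hDdef⟩ : ∃ D : ℕ, D = ∏ i, dI i := ⟨_, rfl⟩
  have hDmul : ∀ i, dI i * ∏ j ∈ Finset.univ.erase i, dI j = D := fun i => hDdef ▸ Finset.mul_prod_erase Finset.univ dI (Finset.mem_univ i)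
  have hlpos : ∀ i, 0 < ∏ j ∈ Finset.univ.erase i, dI j := fun i => Finset.prod_pos fun j _ => hdI j
  have hD : 0 < D := by rw [hDdef]; exact Finset.prod_pos fun j _ => hdI j
  have hadmD : ∀ i, IsAdmissibleCentre p (GModel.initial (p := p) (g₀ := g₀) hq h₀).act g₀ (𝒦 i) D := fun i => hDmul i ▸ isAdmissibleCentre_mul (hadm i) (hlpos i)
  have hverD : ∀ i, VeroneseNormalised (𝒜u i) (fun l => algebraMap (MvPolynomial (Fin 4) k) (Localization.Away (hh i)) (X ((![0, 1, 2] : Fin 3 → Fin 4) l))) (![m i + 2, 1, m i + 1] : Fin 3 → ℕ) D := fun i => hDmul i ▸ CoarseChart.veroneseNormalised_mul _ _ _ (hver i) (hlpos i)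
  have hsuppD : ∀ i, ((((𝒦 i).ideal D).support : Set (GModel.initial (p := p) (g₀ := g₀) hq h₀).V)) ⊆ ((basicOpenStable (GModel.initial (p := p) (g₀ := g₀) hq h₀).act O hO (actO_symm_eq_of_fixed hG (GModel.initial (p := p) (g₀ := g₀) hq h₀) O (eI i) (σI i) (hactI i) (hh i) (hσh i))).1 : Set (GModel.initial (p := p) (g₀ := g₀) hq h₀).V) := fun i => support_ideal_eq_of_pos (𝒦 i) hD (hdI i) ▸ hsupp i
  -- ### disjointness of the supports: `supp 𝒦ᵢ ⊆ Wᵢ ∩ V(x₁ − αᵢ)`, `Wⱼ ⊆ D(x₁ − αᵢ)` for `j ≠ i`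
  have hBsub : ∀ i, ∀ v ∈ ((((𝒦 i).ideal D).support : Set (GModel.initial (p := p) (g₀ := g₀) hq h₀).V)), v ∉ (GModel.initial (p := p) (g₀ := g₀) hq h₀).V.basicOpen ((eI i).symm (X 1)) := by
    intro i v hv hvB
    have hvW : v ∈ (basicOpenStable (GModel.initial (p := p) (g₀ := g₀) hq h₀).act O hO (actO_symm_eq_of_fixed hG (GModel.initial (p := p) (g₀ := g₀) hq h₀) O (eI i) (σI i) (hactI i) (hh i) (hσh i))).1 := hsuppD i hv
    have hs1 : algebraMap Γ((GModel.initial (p := p) (g₀ := g₀) hq h₀).V, O.1) Γ((GModel.initial (p := p) (g₀ := g₀) hq h₀).V, (GModel.initial (p := p) (g₀ := g₀) hq h₀).V.basicOpen ((eI i).symm (hh i))) ((eI i).symm (X 1)) ∈ ((𝒦 i).filtration ⟨(basicOpenStable (GModel.initial (p := p) (g₀ := g₀) hq h₀).act O hO (actO_symm_eq_of_fixed hG (GModel.initial (p := p) (g₀ := g₀) hq h₀) O (eI i) (σI i) (hactI i) (hh i) (hσh i))).1, hWaff i⟩).ideal 1 := by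
      rw [hfil i 1]
      refine Ideal.mem_comap.mpr ?_
      change eW i (algebraMap Γ((GModel.initial (p := p) (g₀ := g₀) hq h₀).V, O.1) Γ((GModel.initial (p := p) (g₀ := g₀) hq h₀).V, (GModel.initial (p := p) (g₀ := g₀) hq h₀).V.basicOpen ((eI i).symm (hh i))) ((eI i).symm (X 1))) ∈ (traceFiltration (𝒜u i) (fun l => algebraMap (MvPolynomial (Fin 4) k) (Localization.Away (hh i)) (X ((![0, 1, 2] : Fin 3 → Fin 4) l))) (![m i + 2, 1, m i + 1] : Fin 3 → ℕ)).ideal 1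
      rw [mem_traceFiltration_iff, hpinW i, (eI i).apply_symm_apply]
      exact mem_weightedFiltration_ideal (fun l => algebraMap (MvPolynomial (Fin 4) k) (Localization.Away (hh i)) (X ((![0, 1, 2] : Fin 3 → Fin 4) l))) (![m i + 2, 1, m i + 1] : Fin 3 → ℕ) 1
    have hnot : v ∉ (GModel.initial (p := p) (g₀ := g₀) hq h₀).V.basicOpen (algebraMap Γ((GModel.initial (p := p) (g₀ := g₀) hq h₀).V, O.1) Γ((GModel.initial (p := p) (g₀ := g₀) hq h₀).V, (GModel.initial (p := p) (g₀ := g₀) hq h₀).V.basicOpen ((eI i).symm (hh i))) ((eI i).symm (X 1))) :=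
      ReesFiltration.not_mem_basicOpen_of_mem_support (𝒦 i) hD one_pos ⟨(basicOpenStable (GModel.initial (p := p) (g₀ := g₀) hq h₀).act O hO (actO_symm_eq_of_fixed hG (GModel.initial (p := p) (g₀ := g₀) hq h₀) O (eI i) (σI i) (hactI i) (hh i) (hσh i))).1, hWaff i⟩ _ hs1 hv hvW
    rw [RingHom.algebraMap_toAlgebra, Scheme.basicOpen_res] at hnot
    exact hnot ⟨(hW1 i).le hvW, hvB⟩
  have hWle : ∀ i j, i ≠ j → (basicOpenStable (GModel.initial (p := p) (g₀ := g₀) hq h₀).act O hO (actO_symm_eq_of_fixed hG (GModel.initial (p := p) (g₀ := g₀) hq h₀) O (eI j) (σI j) (hactI j) (hh j) (hσh j))).1 ≤ (GModel.initial (p := p) (g₀ := g₀) hq h₀).V.basicOpen ((eI i).symm (X 1)) := by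
    intro i j hij
    have hdvd : (X 1 - C (α i) : (MvPolynomial (Fin 4) k)) ∣ (γ j).symm (hh j) := by
      rw [hhh j, map_prod]
      refine dvd_trans ?_ (Finset.dvd_prod_of_mem _ (Finset.mem_erase.mpr ⟨hij, Finset.mem_univ i⟩))
      rw [map_prod]
      refine dvd_trans ?_ (Finset.dvd_prod_of_mem _ (Finset.mem_univ (0 : ZMod p)))
      rw [ZMod.val_zero, Nat.cast_zero, zero_mul, add_zero, map_add, hγs1 j, show (γ j).symm (C (α j - α i)) = C (α j - α i) from (γ j).symm.commutes _, map_sub]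
      exact ⟨1, by ring⟩
    obtain ⟨cc, hcc⟩ := hdvd
    rw [hW1 j, heIs j, hcc, map_mul, Scheme.basicOpen_mul, heIs i, hγs1]
    exact inf_le_left
  have hdisj : Pairwise fun i j => Disjoint ((((𝒦 i).ideal D).support : Set (GModel.initial (p := p) (g₀ := g₀) hq h₀).V)) ((((𝒦 j).ideal D).support : Set (GModel.initial (p := p) (g₀ := g₀) hq h₀).V)) := fun i j hij =>
    Set.disjoint_left.mpr fun v hvi hvj => hBsub i v hvi (hWle i j hij (hsuppD j hvj))
  have hWoff : ∀ i j, j ≠ i → Disjoint (((basicOpenStable (GModel.initial (p := p) (g₀ := g₀) hq h₀).act O hO (actO_symm_eq_of_fixed hG (GModel.initial (p := p) (g₀ := g₀) hq h₀) O (eI i) (σI i) (hactI i) (hh i) (hσh i))).1 : Set (GModel.initial (p := p) (g₀ := g₀) hq h₀).V)) ((((𝒦 j).ideal D).support : Set (GModel.initial (p := p) (g₀ := g₀) hq h₀).V)) := fun i j hji =>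
    Set.disjoint_left.mpr fun v hvW hvj => hBsub j v hvj (hWle j i hji hvW)
  -- ### the glued centre of MOVE 1
  have hadmg := MultiRoot.isAdmissibleCentre_infRees_of_disjoint (GModel.initial (p := p) (g₀ := g₀) hq h₀) 𝒦 hD hadmD hdisj
  have h𝒦G : ∀ (g' : G) (n : ℕ), ((infRees 𝒦).ideal n).comap ((GModel.initial (p := p) (g₀ := g₀) hq h₀).act.aut g').hom = (infRees 𝒦).ideal n := hadmg.2.1
  have h𝒦O : ∀ i n, ((infRees 𝒦).filtration ⟨(basicOpenStable (GModel.initial (p := p) (g₀ := g₀) hq h₀).act O hO (actO_symm_eq_of_fixed hG (GModel.initial (p := p) (g₀ := g₀) hq h₀) O (eI i) (σI i) (hactI i) (hh i) (hσh i))).1, hWaff i⟩).ideal n = ((traceFiltration (𝒜u i) (fun l => algebraMap (MvPolynomial (Fin 4) k) (Localization.Away (hh i)) (X ((![0, 1, 2] : Fin 3 → Fin 4) l))) (![m i + 2, 1, m i + 1] : Fin 3 → ℕ)).ideal n).comap (eW i : Γ((GModel.initial (p := p) (g₀ := g₀) hq h₀).V, (basicOpenStable (GModel.initial (p := p) (g₀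 := g₀) hq h₀).act O hO (actO_symm_eq_of_fixed hG (GModel.initial (p := p) (g₀ := g₀) hq h₀) O (eI i) (σI i) (hactI i) (hh i) (hσh i))).1) →+* ↥(𝒜u i 0)) :=
    fun i n => (MultiRoot.filtration_infRees_eq_of_disjoint 𝒦 hD ⟨(basicOpenStable (GModel.initial (p := p) (g₀ := g₀) hq h₀).act O hO (actO_symm_eq_of_fixed hG (GModel.initial (p := p) (g₀ := g₀) hq h₀) O (eI i) (σI i) (hactI i) (hh i) (hσh i))).1, hWaff i⟩ i (hWoff i) n).trans (hfil i n)
  have hsuppW : (((((infRees 𝒦).ideal D).support : Set (GModel.initial (p := p) (g₀ := g₀) hq h₀).V))) ⊆ ⋃ i, ((basicOpenStable (GModel.initial (p := p) (g₀ := g₀) hq h₀).act O hO (actO_symm_eq_of_fixed hG (GModel.initial (p := p) (g₀ := g₀) hq h₀) O (eI i) (σI i) (hactI i) (hh i) (hσh i))).1 : Set (GModel.initial (p := p) (g₀ := g₀) hq h₀).V) :=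
    (MultiRoot.support_infRees_subset 𝒦 D).trans (Set.iUnion_mono fun i => hsuppD i)
  have hb : ∀ i, e₀ ((eI i).symm (hh i)) = ∏ j ∈ Finset.univ.erase i, ∏ l : ZMod p, (X 1 - C (α i) + C (α i - α j) + (l.val : (MvPolynomial (Fin 4) k)) * X 0) := by
    intro i
    rw [heIs, e₀.apply_symm_apply, hhh i, map_prod]
    refine Finset.prod_congr rfl fun j _ => ?_
    rw [map_prod]
    refine Finset.prod_congr rfl fun l _ => ?_
    rw [map_add, map_add, map_mul, map_natCast, hγs1, hγs0, show (γ i).symm (C (α i - α j)) = C (α i - α j) from (γ i).symm.commutes _]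
  have hF₀ : (NodeAtlasData.ofNodeAtlas (p := p) (ρ := (⟨ρ, hq⟩ : ActionOver q G)) (g₀ := g₀) h₀).fLocus ⊆ ⋃ i, ((basicOpenStable (GModel.initial (p := p) (g₀ := g₀) hq h₀).act O hO (actO_symm_eq_of_fixed hG (GModel.initial (p := p) (g₀ := g₀) hq h₀) O (eI i) (σI i) (hactI i) (hh i) (hσh i))).1 : Set (GModel.initial (p := p) (g₀ := g₀) hq h₀).V) :=
    fLocus_subset_iUnion_basicOpen_locPoly hG (GModel.initial (p := p) (g₀ := g₀) hq h₀) O hOuniv e₀ σ hC h0 h1 hact hr α hα (fun i => (eI i).symm (hh i)) hb _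
  have hcovX : ∀ u : (GModel.initial (p := p) (g₀ := g₀) hq h₀).V, u ∈ (GModel.initial (p := p) (g₀ := g₀) hq h₀).V.basicOpen (e₀.symm (X 0)) ∨ ∃ i, u ∈ (basicOpenStable (GModel.initial (p := p) (g₀ := g₀) hq h₀).act O hO (actO_symm_eq_of_fixed hG (GModel.initial (p := p) (g₀ := g₀) hq h₀) O (eI i) (σI i) (hactI i) (hh i) (hσh i))).1 := fun u =>
    mem_basicOpen_X_zero_or_locPoly (GModel.initial (p := p) (g₀ := g₀) hq h₀) O e₀ hr α hα (fun i => (eI i).symm (hh i)) hb (hOuniv u)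
  -- ### KillsIn 2: MOVE 1 is the glued root; fix a realisation `M₁`
  refine ⟨infRees 𝒦, D, hadmg, fun M₁ hm₁ => ⟨⟨NodeAtlasData.ofNodeAtlas (p := p) (ρ := M₁.act) (g₀ := g₀) M₁.atlas⟩, ?_⟩⟩
  obtain ⟨π₁, hbl, -, hrM, hcomm⟩ := hm₁
  haveI : M₁.V.IsSeparated := isSeparated_of_datum φ M₁
  -- ### MOVE 1 on `M₁`: per-point ring data at the common degree `dbar = D·p·∏ⱼ(mⱼ+2)(mⱼ+1)`
  have hPT : ∀ i, (m i + 2) * (m i + 1) * (∏ j ∈ Finset.univ.erase i, ((m j + 2) * (m j + 1))) = (∏ j : Fin r, ((m j + 2) * (m j + 1))) := fun i =>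
    Finset.mul_prod_erase Finset.univ (fun j => (m j + 2) * (m j + 1)) (Finset.mem_univ i)
  have hPpos : ∀ i, 0 < (∏ j ∈ Finset.univ.erase i, ((m j + 2) * (m j + 1))) := fun i => Finset.prod_pos fun j _ => Nat.mul_pos (Nat.succ_pos _) (Nat.succ_pos _)
  have hPTpos : 0 < (∏ j : Fin r, ((m j + 2) * (m j + 1))) := Finset.prod_pos fun j _ => Nat.mul_pos (Nat.succ_pos _) (Nat.succ_pos _)
  have hkk : 0 < p * (∏ j : Fin r, ((m j + 2) * (m j + 1))) := Nat.mul_pos hp.pos hPTpos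
  have hn₀ : ∀ i, 0 < (D * p * (m i + 1) * (∏ j ∈ Finset.univ.erase i, ((m j + 2) * (m j + 1)))) := fun i => Nat.mul_pos (Nat.mul_pos (Nat.mul_pos hD hp.pos) (Nat.succ_pos _)) (hPpos i)
  have hn₁ : 0 < D * (∏ j : Fin r, ((m j + 2) * (m j + 1))) := Nat.mul_pos hD hPTpos
  have hn₂ : ∀ i, 0 < (D * (m i + 2) * (∏ j ∈ Finset.univ.erase i, ((m j + 2) * (m j + 1)))) := fun i => Nat.mul_pos (Nat.mul_pos hD (Nat.succ_pos _)) (hPpos i)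
  have hd₀ : ∀ i, (D * (p * (∏ j : Fin r, ((m j + 2) * (m j + 1))))) = (m i + 2) * (D * p * (m i + 1) * (∏ j ∈ Finset.univ.erase i, ((m j + 2) * (m j + 1)))) := fun i => by rw [← hPT i]; ring
  have hd₁ : (D * (p * (∏ j : Fin r, ((m j + 2) * (m j + 1))))) = p * (D * (∏ j : Fin r, ((m j + 2) * (m j + 1)))) := by ring
  have hd₂ : ∀ i, (D * (p * (∏ j : Fin r, ((m j + 2) * (m j + 1))))) = (m i + 1) * p * (D * (m i + 2) * (∏ j ∈ Finset.univ.erase i, ((m j + 2) * (m j + 1)))) := fun i => by rw [← hPT i]; ring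
  have hrd := fun i => KillCert.QhAway.graphRoot_ringData' (σI i) (h0I i) (h1I i) (h2I i) (m i) (wloc i) (h3I i) (hh i) (hσh i) hp.pos (hσpL i) (hσJ i) (ht i)
    ![] (𝒜u i) (hfull0 i) (hσpI i) (hh0 i) (D * (p * (∏ j : Fin r, ((m j + 2) * (m j + 1))))) (D * p * (m i + 1) * (∏ j ∈ Finset.univ.erase i, ((m j + 2) * (m j + 1)))) (D * (∏ j : Fin r, ((m j + 2) * (m j + 1)))) (D * (m i + 2) * (∏ j ∈ Finset.univ.erase i, ((m j + 2) * (m j + 1)))) (hn₀ i) hn₁ (hn₂ i) (hd₀ i) hd₁ (hd₂ i)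
  choose y hy hσy hy0 hy1 hy2 hc0 hc1 hdvd hrad hres using hrd
  obtain ⟨OW, hOWaff, hOWeq, E, htame', hE', hpin, 𝔄₁, hF₁⟩ := exists_moveAtlas_of_nodes hp.pos hG (GModel.initial (p := p) (g₀ := g₀) hq h₀) M₁
    (NodeAtlasData.ofNodeAtlas (p := p) (ρ := (⟨ρ, hq⟩ : ActionOver q G)) (g₀ := g₀) h₀) (fun i => (basicOpenStable (GModel.initial (p := p) (g₀ := g₀) hq h₀).act O hO (actO_symm_eq_of_fixed hG (GModel.initial (p := p) (g₀ := g₀) hq h₀) O (eI i) (σI i) (hactI i) (hh i) (hσh i)))) hWaff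
    ![] 𝒜u (fun i => (fun l => algebraMap (MvPolynomial (Fin 4) k) (Localization.Away (hh i)) (X ((![0, 1, 2] : Fin 3 → Fin 4) l)))) (δ := fun _ _ => (0 : (Π j : Fin 0, ZMod ((![] : Fin 0 → ℕ) j)))) (fun i => (![m i + 2, 1, m i + 1] : Fin 3 → ℕ)) hfA (fun i => (sigmaAway (σI i) (hσh i))) eW htame hσpL hσW hw hK1 hK1' hσJ
    (infRees 𝒦) D h𝒦G h𝒦O hverD hsuppW π₁ hbl hrM hcomm hkk y hy hσy hrad
    (fun i => cobordantAlgebra.s (fun l => algebraMap (MvPolynomial (Fin 4) k) (Localization.Away (hh i)) (X ((![0, 1, 2] : Fin 3 → Fin 4) l))) (![m i + 2, 1, m i + 1] : Fin 3 → ℕ) ^ (m i + 1))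
    (fun i => KillCert.QhAway.qhl_augmentationIdeal_sigmaR_le (σI i) (hCI i) (h0I i) (h1I i) (h2I i) (X 2 - X 1 ^ (m i + 1) * Polynomial.aeval (X 1 : MvPolynomial (Fin 4) k) (wloc i) : MvPolynomial (Fin 4) k) (h3I i) (![m i + 2, 1, m i + 1] : Fin 3 → ℕ) (m i + 1) (hw0 i) (ht0 i) (hh i) (hσh i)
      hp.pos (hσpI i) (hσJ i))
    (fun _ _ => 2)
    (fun i j => ![algebraMap _ (ChartRing (𝒜u i) (fun l => algebraMap (MvPolynomial (Fin 4) k) (Localization.Away (hh i)) (X ((![0, 1, 2] : Fin 3 → Fin 4) l))) (![m i + 2, 1, m i + 1] : Fin 3 → ℕ) (D * (p * (∏ j : Fin r, ((m j + 2) * (m j + 1))))) (y i j) (hy i j)) (cobordantAlgebra.u' (fun l => algebraMap (MvPolynomial (Fin 4) k) (Localization.Away (hh i)) (X ((![0, 1, 2] : Fin 3 → Fin 4) l))) (![m i + 2, 1, m i + 1] : Fin 3 → ℕ) 0 ^ (D * p * (m i + 1) * (∏ j ∈ Finset.univ.erase i, ((m j + 2) * (m j + 1))))) * IsLocalization.Away.invSelf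 ((coverElement (𝒜u i) (fun l => algebraMap (MvPolynomial (Fin 4) k) (Localization.Away (hh i)) (X ((![0, 1, 2] : Fin 3 → Fin 4) l))) (![m i + 2, 1, m i + 1] : Fin 3 → ℕ) (D * (p * (∏ j : Fin r, ((m j + 2) * (m j + 1)))))) (y i j) (hy i j)),
      algebraMap _ (ChartRing (𝒜u i) (fun l => algebraMap (MvPolynomial (Fin 4) k) (Localization.Away (hh i)) (X ((![0, 1, 2] : Fin 3 → Fin 4) l))) (![m i + 2, 1, m i + 1] : Fin 3 → ℕ) (D * (p * (∏ j : Fin r, ((m j + 2) * (m j + 1))))) (y i j) (hy i j)) ((coverElement (𝒜u i) (fun l => algebraMap (MvPolynomial (Fin 4) k) (Localization.Away (hh i)) (X ((![0, 1, 2] : Fin 3 → Fin 4) l))) (![m i + 2, 1, m i + 1] : Fin 3 → ℕ) (D * (p * (∏ j : Fin r, ((m j + 2) * (m j + 1)))))) (y i 2) (hy i 2)) * IsLocalization.Away.invSelf ((coverElement (𝒜u i) (fun l => algebraMap (MvPolynomial (Fin 4) k) (Localization.Away (hh i)) (X ((![0, 1, 2] : Fin 3 → Fin 4) l))) (![m i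 + 2, 1, m i + 1] : Fin 3 → ℕ) (D * (p * (∏ j : Fin r, ((m j + 2) * (m j + 1)))))) (y i j) (hy i j))])
    (fun i j l => Fin.cases (hres i j).1.1 (Fin.cases (hres i j).2.1 (fun l' => l'.elim0)) l)
    (fun i j l => Fin.cases (hres i j).1.2 (Fin.cases (hres i j).2.2 (fun l' => l'.elim0)) l)
  have hWle₁ : ∀ i j, (OW i j).1 ≤ π₁ ⁻¹ᵁ (basicOpenStable (GModel.initial (p := p) (g₀ := g₀) hq h₀).act O hO (actO_symm_eq_of_fixed hG (GModel.initial (p := p) (g₀ := g₀) hq h₀) O (eI i) (σI i) (hactI i) (hh i) (hσh i))).1 := fun i j => by rw [hOWeq i j]; exact blowupChart_le_preimage π₁ _ ⟨(basicOpenStable (GModel.initial (p := p) (g₀ := g₀) hq h₀).act O hO (actO_symm_eq_of_fixed hG (GModel.initial (p := p) (g₀ := g₀) hq h₀) O (eI i) (σI i) (hactI i) (hh i) (hσh i))).1, hWaff i⟩ _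
  -- ### the charts `(i,0)` and `(i,2)` are killed
  have hunit0 : ∀ i, algebraMap _ (ChartRing (𝒜u i) (fun l => algebraMap (MvPolynomial (Fin 4) k) (Localization.Away (hh i)) (X ((![0, 1, 2] : Fin 3 → Fin 4) l))) (![m i + 2, 1, m i + 1] : Fin 3 → ℕ) (D * (p * (∏ j : Fin r, ((m j + 2) * (m j + 1))))) (y i 0) (hy i 0)) (cobordantAlgebra.u' (fun l => algebraMap (MvPolynomial (Fin 4) k) (Localization.Away (hh i)) (X ((![0, 1, 2] : Fin 3 → Fin 4) l))) (![m i + 2, 1, m i + 1] : Fin 3 → ℕ) 0 ^ (D * p * (m i + 1) * (∏ j ∈ Finset.univ.erase i, ((m j + 2) * (m j + 1))))) * IsLocalization.Away.invSelf ((coverElement (𝒜u i) (fun l => algebraMap (MvPolynomial (Fin 4) k) (Localization.Away (hh i)) (X ((![0, 1, 2] : Fin 3 → Fin 4) l))) (![m i + 2, 1, m i + 1] : Fin 3 → ℕ) (D * (p * (∏ j : Fin r, ((m j + 2) * (m j + 1)))))) (y i 0) (hy i 0)) = 1 :=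
    fun i => by rw [← hc0 i]; exact IsLocalization.Away.mul_invSelf _
  have hunit2 : ∀ i, algebraMap _ (ChartRing (𝒜u i) (fun l => algebraMap (MvPolynomial (Fin 4) k) (Localization.Away (hh i)) (X ((![0, 1, 2] : Fin 3 → Fin 4) l))) (![m i + 2, 1, m i + 1] : Fin 3 → ℕ) (D * (p * (∏ j : Fin r, ((m j + 2) * (m j + 1))))) (y i 2) (hy i 2)) ((coverElement (𝒜u i) (fun l => algebraMap (MvPolynomial (Fin 4) k) (Localization.Away (hh i)) (X ((![0, 1, 2] : Fin 3 → Fin 4) l))) (![m i + 2, 1, m i + 1] : Fin 3 → ℕ) (D * (p * (∏ j : Fin r, ((m j + 2) * (m j + 1)))))) (y i 2) (hy i 2)) * IsLocalization.Away.invSelf ((coverElement (𝒜u i) (fun l => algebraMap (MvPolynomial (Fin 4) k) (Localization.Away (hh i)) (X ((![0, 1, 2] : Fin 3 → Fin 4) l))) (![m i + 2, 1, m i + 1] : Fin 3 → ℕ) (D * (p * (∏ j : Fin r, ((m j + 2) * (m j + 1)))))) (y i 2) (hy i 2)) = 1 :=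
    fun i => IsLocalization.Away.mul_invSelf _
  have hz0W : ∀ i, ∀ v ∈ (OW i 0).1, v ∈ M₁.V.basicOpen
      (letI := chartNodeGradedRing ![] (𝒜u i) (fun l => algebraMap (MvPolynomial (Fin 4) k) (Localization.Away (hh i)) (X ((![0, 1, 2] : Fin 3 → Fin 4) l))) (![m i + 2, 1, m i + 1] : Fin 3 → ℕ) (hfA i) (D * (p * (∏ j : Fin r, ((m j + 2) * (m j + 1))))) (y i 0) (hy i 0); (E i 0).symm ⟨_, (hres i 0).1.1⟩) := fun i v hv => by
    letI := chartNodeGradedRing ![] (𝒜u i) (fun l => algebraMap (MvPolynomial (Fin 4) k) (Localization.Away (hh i)) (X ((![0, 1, 2] : Fin 3 → Fin 4) l))) (![m i + 2, 1, m i + 1] : Fin 3 → ℕ) (hfA i) (D * (p * (∏ j : Fin r, ((m j + 2) * (m j + 1))))) (y i 0) (hy i 0)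
    rw [show (⟨_, (hres i 0).1.1⟩ : ↥((chartNodeGrading ![] (𝒜u i) (fun l => algebraMap (MvPolynomial (Fin 4) k) (Localization.Away (hh i)) (X ((![0, 1, 2] : Fin 3 → Fin 4) l))) (![m i + 2, 1, m i + 1] : Fin 3 → ℕ) (hfA i) (D * (p * (∏ j : Fin r, ((m j + 2) * (m j + 1))))) (y i 0) (hy i 0)) 0)) = 1 from Subtype.ext (hunit0 i), map_one, Scheme.basicOpen_of_isUnit _ isUnit_one]; exact hv
  have hz2W : ∀ i, ∀ v ∈ (OW i 2).1, v ∈ M₁.V.basicOpen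
      (letI := chartNodeGradedRing ![] (𝒜u i) (fun l => algebraMap (MvPolynomial (Fin 4) k) (Localization.Away (hh i)) (X ((![0, 1, 2] : Fin 3 → Fin 4) l))) (![m i + 2, 1, m i + 1] : Fin 3 → ℕ) (hfA i) (D * (p * (∏ j : Fin r, ((m j + 2) * (m j + 1))))) (y i 2) (hy i 2); (E i 2).symm ⟨_, (hres i 2).2.1⟩) := fun i v hv => by
    letI := chartNodeGradedRing ![] (𝒜u i) (fun l => algebraMap (MvPolynomial (Fin 4) k) (Localization.Away (hh i)) (X ((![0, 1, 2] : Fin 3 → Fin 4) l))) (![m i + 2, 1, m i + 1] : Fin 3 → ℕ) (hfA i) (D * (p * (∏ j : Fin r, ((m j + 2) * (m j + 1))))) (y i 2) (hy i 2)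
    rw [show (⟨_, (hres i 2).2.1⟩ : ↥((chartNodeGrading ![] (𝒜u i) (fun l => algebraMap (MvPolynomial (Fin 4) k) (Localization.Away (hh i)) (X ((![0, 1, 2] : Fin 3 → Fin 4) l))) (![m i + 2, 1, m i + 1] : Fin 3 → ℕ) (hfA i) (D * (p * (∏ j : Fin r, ((m j + 2) * (m j + 1))))) (y i 2) (hy i 2)) 0)) = 1 from Subtype.ext (hunit2 i), map_one, Scheme.basicOpen_of_isUnit _ isUnit_one]; exact hv
  have hF₁W : 𝔄₁.fLocus ⊆ ⋃ i, (((OW i 1)).1 : Set M₁.V) := by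
    intro v hv
    rcases hF₁ hv with hold | hnew
    · exact absurd (Set.mem_iUnion.mp (hF₀ hold.1)) (fun h => hold.2 (Set.mem_iUnion.mpr h))
    · obtain ⟨i, hi⟩ := Set.mem_iUnion.mp hnew
      obtain ⟨j, hvW, hvR⟩ := Set.mem_iUnion.mp hi
      revert hvW hvR
      refine Fin.cases ?_ (Fin.cases ?_ (Fin.cases ?_ (fun l => l.elim0))) j
      · intro hvW hvR; exact absurd (hz0W i v hvW) (hvR 0)
      · intro hvW _; exact Set.mem_iUnion.mpr ⟨i, hvW⟩
      · intro hvW hvR; exact absurd (hz2W i v hvW) (hvR 1)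
  -- ### the producer charts cover `π⁻¹ Wᵢ`; transition sections
  have hπ' : IsBlowup π₁ ((infRees 𝒦).ideal D ^ (p * (∏ j : Fin r, ((m j + 2) * (m j + 1))))) := isBlowup_pow hbl hkk.ne'
  have hverbar : ∀ i, VeroneseNormalised (𝒜u i) (fun l => algebraMap (MvPolynomial (Fin 4) k) (Localization.Away (hh i)) (X ((![0, 1, 2] : Fin 3 → Fin 4) l))) (![m i + 2, 1, m i + 1] : Fin 3 → ℕ) (D * (p * (∏ j : Fin r, ((m j + 2) * (m j + 1))))) := fun i => CoarseChart.veroneseNormalised_mul _ _ _ (hverD i) hkk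
  have hJ' : ∀ i, ((infRees 𝒦).ideal D ^ (p * (∏ j : Fin r, ((m j + 2) * (m j + 1))))).ideal ⟨(basicOpenStable (GModel.initial (p := p) (g₀ := g₀) hq h₀).act O hO (actO_symm_eq_of_fixed hG (GModel.initial (p := p) (g₀ := g₀) hq h₀) O (eI i) (σI i) (hactI i) (hh i) (hσh i))).1, hWaff i⟩ = ((traceFiltration (𝒜u i) (fun l => algebraMap (MvPolynomial (Fin 4) k) (Localization.Away (hh i)) (X ((![0, 1, 2] : Fin 3 → Fin 4) l))) (![m i + 2, 1, m i + 1] : Fin 3 → ℕ)).ideal (D * (p * (∏ j : Fin r, ((m j + 2) * (m j + 1)))))).comap (eW i : Γ((GModel.initial (p := p) (g₀ := g₀) hq h₀).V, (basicOpenStable (GModel.initial (p := p) (g₀ := g₀) hq h₀).act O hO (actO_symm_eq_of_fixed hG (GModel.initial (p := p) (g₀ := g₀) hq h₀) O (eI i) (σI i) (hactI i) (hh i) (hσh i))).1) →+* ↥(𝒜u i 0)) := fun i => by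
    rw [Scheme.IdealSheafData.ideal_pow, Pi.pow_apply, ← ReesFiltration.filtration_ideal, h𝒦O i D, (hverD i).2 (p * (∏ j : Fin r, ((m j + 2) * (m j + 1)))), comap_equiv_pow]
  have hxJ : ∀ i j, (eW i).symm (y i j) ∈ ((infRees 𝒦).ideal D ^ (p * (∏ j : Fin r, ((m j + 2) * (m j + 1))))).ideal ⟨(basicOpenStable (GModel.initial (p := p) (g₀ := g₀) hq h₀).act O hO (actO_symm_eq_of_fixed hG (GModel.initial (p := p) (g₀ := g₀) hq h₀) O (eI i) (σI i) (hactI i) (hh i) (hσh i))).1, hWaff i⟩ := fun i j => by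
    rw [hJ' i, Ideal.mem_comap, RingHom.coe_coe, (eW i).apply_symm_apply]; exact hy i j
  have hcovM : ∀ (x : M₁.V) i, π₁.base x ∈ (basicOpenStable (GModel.initial (p := p) (g₀ := g₀) hq h₀).act O hO (actO_symm_eq_of_fixed hG (GModel.initial (p := p) (g₀ := g₀) hq h₀) O (eI i) (σI i) (hactI i) (hh i) (hσh i))).1 → ∃ j, x ∈ (OW i j).1 := fun x i hxi => by
    have hcovW := iSup_blowupChart_eq_preimage (I := (infRees 𝒦).ideal D) (GModel.initial (p := p) (g₀ := g₀) hq h₀).act ![] (𝒜u i) (fun l => algebraMap (MvPolynomial (Fin 4) k) (Localization.Away (hh i)) (X ((![0, 1, 2] : Fin 3 → Fin 4) l))) (![m i + 2, 1, m i + 1] : Fin 3 → ℕ) (hfA i) (basicOpenStable (GModel.initial (p := p) (g₀ := g₀) hq h₀).act O hO (actO_symm_eq_of_fixed hG (GModel.initial (p := p) (g₀ := g₀) hq h₀) O (eI i) (σI i) (hactI i) (hh i) (hσh i))) (hWaff i) (eW i) hπ' (hverbar i) (hJ' i)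
      (y i) (hy i) (hrad i)
    obtain ⟨j, hj⟩ := Opens.mem_iSup.mp (show x ∈ ⨆ j, blowupChart π₁ ((infRees 𝒦).ideal D ^ (p * (∏ j : Fin r, ((m j + 2) * (m j + 1))))) ⟨(basicOpenStable (GModel.initial (p := p) (g₀ := g₀) hq h₀).act O hO (actO_symm_eq_of_fixed hG (GModel.initial (p := p) (g₀ := g₀) hq h₀) O (eI i) (σI i) (hactI i) (hh i) (hσh i))).1, hWaff i⟩ ((eW i).symm (y i j)) by rw [hcovW]; exact hxi)
    exact ⟨j, (congrArg (fun U : M₁.V.Opens => x ∈ U) (hOWeq i j)).mpr hj⟩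
  have htrans : ∀ i (j j' : Fin 3), letI := chartNodeGradedRing ![] (𝒜u i) (fun l => algebraMap (MvPolynomial (Fin 4) k) (Localization.Away (hh i)) (X ((![0, 1, 2] : Fin 3 → Fin 4) l))) (![m i + 2, 1, m i + 1] : Fin 3 → ℕ) (hfA i) (D * (p * (∏ j : Fin r, ((m j + 2) * (m j + 1))))) (y i j) (hy i j)
      ∃ t : Γ(M₁.V, (OW i j).1),
        ((E i j t : ↥((chartNodeGrading ![] (𝒜u i) (fun l => algebraMap (MvPolynomial (Fin 4) k) (Localization.Away (hh i)) (X ((![0, 1, 2] : Fin 3 → Fin 4) l))) (![m i + 2, 1, m i + 1] : Fin 3 → ℕ) (hfA i) (D * (p * (∏ j : Fin r, ((m j + 2) * (m j + 1))))) (y i j) (hy i j)) 0)) : (ChartRing (𝒜u i) (fun l => algebraMap (MvPolynomial (Fin 4) k) (Localization.Away (hh i)) (X ((![0, 1, 2] : Fin 3 → Fin 4) l))) (![m i + 2, 1, m i + 1] : Fin 3 → ℕ) (D * (p * (∏ j : Fin r, ((m j + 2) * (m j + 1))))) (y i j) (hy i j))) = algebraMap _ (ChartRing (𝒜u i) (fun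 l => algebraMap (MvPolynomial (Fin 4) k) (Localization.Away (hh i)) (X ((![0, 1, 2] : Fin 3 → Fin 4) l))) (![m i + 2, 1, m i + 1] : Fin 3 → ℕ) (D * (p * (∏ j : Fin r, ((m j + 2) * (m j + 1))))) (y i j) (hy i j)) ((coverElement (𝒜u i) (fun l => algebraMap (MvPolynomial (Fin 4) k) (Localization.Away (hh i)) (X ((![0, 1, 2] : Fin 3 → Fin 4) l))) (![m i + 2, 1, m i + 1] : Fin 3 → ℕ) (D * (p * (∏ j : Fin r, ((m j + 2) * (m j + 1)))))) (y i j') (hy i j')) * IsLocalization.Away.invSelf ((coverElement (𝒜u i) (fun l => algebraMap (MvPolynomial (Fin 4) k) (Localization.Away (hh i)) (X ((![0, 1, 2] : Fin 3 → Fin 4) l))) (![m i + 2, 1, m i + 1] : Fin 3 → ℕ) (D * (p * (∏ j : Fin r, ((m j + 2) * (m j + 1)))))) (y i j) (hy i j)) ∧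
        ∀ v ∈ (OW i j).1, v ∈ (OW i j').1 → v ∈ M₁.V.basicOpen t := by
    intro i j j'
    letI := chartNodeGradedRing ![] (𝒜u i) (fun l => algebraMap (MvPolynomial (Fin 4) k) (Localization.Away (hh i)) (X ((![0, 1, 2] : Fin 3 → Fin 4) l))) (![m i + 2, 1, m i + 1] : Fin 3 → ℕ) (hfA i) (D * (p * (∏ j : Fin r, ((m j + 2) * (m j + 1))))) (y i j) (hy i j)
    have hmem := transitionSection_mem_chartNodeGrading_zero ![] (𝒜u i) (fun l => algebraMap (MvPolynomial (Fin 4) k) (Localization.Away (hh i)) (X ((![0, 1, 2] : Fin 3 → Fin 4) l))) (![m i + 2, 1, m i + 1] : Fin 3 → ℕ) (hfA i) (y i j) (hy i j) (y i j') (hy i j')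
    have hpz : (E i j).symm ⟨_, hmem⟩ * π₁.appLE (basicOpenStable (GModel.initial (p := p) (g₀ := g₀) hq h₀).act O hO (actO_symm_eq_of_fixed hG (GModel.initial (p := p) (g₀ := g₀) hq h₀) O (eI i) (σI i) (hactI i) (hh i) (hσh i))).1 (OW i j).1 (hWle₁ i j) ((eW i).symm (y i j)) = π₁.appLE (basicOpenStable (GModel.initial (p := p) (g₀ := g₀) hq h₀).act O hO (actO_symm_eq_of_fixed hG (GModel.initial (p := p) (g₀ := g₀) hq h₀) O (eI i) (σI i) (hactI i) (hh i) (hσh i))).1 (OW i j).1 (hWle₁ i j) ((eW i).symm (y i j')) :=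
      symm_mul_appLE_eq_of_pin π₁ (basicOpenStable (GModel.initial (p := p) (g₀ := g₀) hq h₀).act O hO (actO_symm_eq_of_fixed hG (GModel.initial (p := p) (g₀ := g₀) hq h₀) O (eI i) (σI i) (hactI i) (hh i) (hσh i))).1 (OW i j).1 (hWle₁ i j) (chartNodeGrading ![] (𝒜u i) (fun l => algebraMap (MvPolynomial (Fin 4) k) (Localization.Away (hh i)) (X ((![0, 1, 2] : Fin 3 → Fin 4) l))) (![m i + 2, 1, m i + 1] : Fin 3 → ℕ) (hfA i) (D * (p * (∏ j : Fin r, ((m j + 2) * (m j + 1))))) (y i j) (hy i j)) (E i j) (eW i)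
        (toChartRing (𝒜u i) (fun l => algebraMap (MvPolynomial (Fin 4) k) (Localization.Away (hh i)) (X ((![0, 1, 2] : Fin 3 → Fin 4) l))) (![m i + 2, 1, m i + 1] : Fin 3 → ℕ) (D * (p * (∏ j : Fin r, ((m j + 2) * (m j + 1))))) (y i j) (hy i j)) (hpin i j (hWle₁ i j)) ⟨_, hmem⟩ ((eW i).symm (y i j')) ((eW i).symm (y i j)) (y i j') (y i j)
        ((eW i).apply_symm_apply _) ((eW i).apply_symm_apply _) (coverElement_section_pin ![] (𝒜u i) (fun l => algebraMap (MvPolynomial (Fin 4) k) (Localization.Away (hh i)) (X ((![0, 1, 2] : Fin 3 → Fin 4) l))) (![m i + 2, 1, m i + 1] : Fin 3 → ℕ) (y i j) (hy i j) (y i j') (hy i j'))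
    refine ⟨(E i j).symm ⟨_, hmem⟩, by rw [(E i j).apply_symm_apply], fun v hvW hv' => ?_⟩
    exact mem_basicOpen_of_mem_blowupChart_of_mul_appLE_eq hπ' ⟨(basicOpenStable (GModel.initial (p := p) (g₀ := g₀) hq h₀).act O hO (actO_symm_eq_of_fixed hG (GModel.initial (p := p) (g₀ := g₀) hq h₀) O (eI i) (σI i) (hactI i) (hh i) (hσh i))).1, hWaff i⟩ (hxJ i j) (le_of_eq (hOWeq i j)) _ hpz hvW
      ((congrArg (fun U : M₁.V.Opens => v ∈ U) (hOWeq i j')).mp hv')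
  choose tr htrE htrU using htrans
  -- ### MOVE 2: the global sections `x₀`, `x₁ − αᵢ`, `t = x₂ − g(x₁)` and their pull-backs to `O′ᵢⱼ`
  have hγ0 : ∀ i, γ i (X 0) = X 0 := fun i => (hrest i).2.1.1
  have hγ1 : ∀ i, γ i (X 1) = X 1 + C (α i) := fun i => (hrest i).2.1.2.1
  have hO1 : ∀ i j, (OW i j).1 ≤ π₁ ⁻¹ᵁ O.1 := fun i j x _ => Set.mem_univ _
  obtain ⟨tg, htg⟩ : ∃ tg : (MvPolynomial (Fin 4) k), tg = X 2 - Polynomial.aeval (X 1 : (MvPolynomial (Fin 4) k)) g := ⟨_, rfl⟩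
  have hT0γ : ∀ i, (γ i).symm (X 2 - X 1 ^ (m i + 1) * Polynomial.aeval (X 1 : MvPolynomial (Fin 4) k) (wloc i) : MvPolynomial (Fin 4) k) = tg := fun i => htg ▸ GraphTail.recentre_symm_localTail (γ i) g (α i) (m i) (wloc i) (hγs1 i) (hγs2 i) (hwloc i)
  have heIT : ∀ i, (eI i).symm (X 2 - X 1 ^ (m i + 1) * Polynomial.aeval (X 1 : MvPolynomial (Fin 4) k) (wloc i) : MvPolynomial (Fin 4) k) = e₀.symm tg := fun i => by rw [heIs, hT0γ]
  have hγtg : ∀ i, γ i tg = (X 2 - X 1 ^ (m i + 1) * Polynomial.aeval (X 1 : MvPolynomial (Fin 4) k) (wloc i) : MvPolynomial (Fin 4) k) := fun i => by rw [← hT0γ i, (γ i).apply_symm_apply]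
  -- restriction `Γ(O) → Γ(Wᵢ)`; pulling back through `Wᵢ` equals pulling back from `O`; `E`-values of pulled-back sections
  have hWO : ∀ i, (basicOpenStable (GModel.initial (p := p) (g₀ := g₀) hq h₀).act O hO (actO_symm_eq_of_fixed hG (GModel.initial (p := p) (g₀ := g₀) hq h₀) O (eI i) (σI i) (hactI i) (hh i) (hσh i))).1 ≤ O.1 := fun i => (GModel.initial (p := p) (g₀ := g₀) hq h₀).V.basicOpen_le _
  obtain ⟨sW, hsW⟩ : ∃ sW : ∀ i, Γ((GModel.initial (p := p) (g₀ := g₀) hq h₀).V, O.1) →+* Γ((GModel.initial (p := p) (g₀ := g₀) hq h₀).V, (basicOpenStable (GModel.initial (p := p) (g₀ := g₀) hq h₀).act O hO (actO_symm_eq_of_fixed hG (GModel.initial (p := p) (g₀ := g₀) hq h₀) O (eI i) (σI i) (hactI i) (hh i) (hσh i))).1), sW = fun i => ((GModel.initial (p := p) (g₀ := g₀) hq h₀).V.presheaf.map (homOfLE (hWO i)).op).hom := ⟨_, rfl⟩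
  have hpinW' : ∀ i (t : Γ((GModel.initial (p := p) (g₀ := g₀) hq h₀).V, O.1)), ((eW i (sW i t) : ↥(𝒜u i 0)) : (Localization.Away (hh i))) = algebraMap (MvPolynomial (Fin 4) k) (Localization.Away (hh i)) (eI i t) := fun i t => by rw [hsW]; exact hpinW i t
  have hsecres : ∀ i (t : Γ((GModel.initial (p := p) (g₀ := g₀) hq h₀).V, O.1)), (GModel.initial (p := p) (g₀ := g₀) hq h₀).V.basicOpen (sW i t) = (basicOpenStable (GModel.initial (p := p) (g₀ := g₀) hq h₀).act O hO (actO_symm_eq_of_fixed hG (GModel.initial (p := p) (g₀ := g₀) hq h₀) O (eI i) (σI i) (hactI i) (hh i) (hσh i))).1 ⊓ (GModel.initial (p := p) (g₀ := g₀) hq h₀).V.basicOpen t := fun i t => by rw [hsW]; exact Scheme.basicOpen_res _ _ _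
  have hresW : ∀ i j (t : Γ((GModel.initial (p := p) (g₀ := g₀) hq h₀).V, O.1)), π₁.appLE (basicOpenStable (GModel.initial (p := p) (g₀ := g₀) hq h₀).act O hO (actO_symm_eq_of_fixed hG (GModel.initial (p := p) (g₀ := g₀) hq h₀) O (eI i) (σI i) (hactI i) (hh i) (hσh i))).1 (OW i j).1 (hWle₁ i j) (sW i t) = π₁.appLE O.1 (OW i j).1 (hO1 i j) t := fun i j t => by
    rw [hsW]; exact Scheme.Hom.map_appLE_apply π₁ (hWle₁ i j) (hWO i) (hO1 i j) t
  have hEval : ∀ i j (t : Γ((GModel.initial (p := p) (g₀ := g₀) hq h₀).V, O.1)), letI := chartNodeGradedRing ![] (𝒜u i) (fun l => algebraMap (MvPolynomial (Fin 4) k) (Localization.Away (hh i)) (X ((![0, 1, 2] : Fin 3 → Fin 4) l))) (![m i + 2, 1, m i + 1] : Fin 3 → ℕ) (hfA i) (D * (p * (∏ j : Fin r, ((m j + 2) * (m j + 1))))) (y i j) (hy i j)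
      ((E i j (π₁.appLE O.1 (OW i j).1 (hO1 i j) t) : ↥((chartNodeGrading ![] (𝒜u i) (fun l => algebraMap (MvPolynomial (Fin 4) k) (Localization.Away (hh i)) (X ((![0, 1, 2] : Fin 3 → Fin 4) l))) (![m i + 2, 1, m i + 1] : Fin 3 → ℕ) (hfA i) (D * (p * (∏ j : Fin r, ((m j + 2) * (m j + 1))))) (y i j) (hy i j)) 0)) : (ChartRing (𝒜u i) (fun l => algebraMap (MvPolynomial (Fin 4) k) (Localization.Away (hh i)) (X ((![0, 1, 2] : Fin 3 → Fin 4) l))) (![m i + 2, 1, m i + 1] : Fin 3 → ℕ) (D * (p * (∏ j : Fin r, ((m j + 2) * (m j + 1))))) (y i j) (hy i j))) = algebraMap ↥(cobordantAlgebra (fun l => algebraMap (MvPolynomial (Fin 4) k) (Localization.Away (hh i)) (X ((![0, 1, 2] : Fin 3 → Fin 4) l))) (![m i + 2, 1, m i + 1] : Fin 3 → ℕ)) (ChartRing (𝒜u i) (fun l => algebraMap (MvPolynomial (Fin 4) k) (Localization.Away (hh i)) (X ((![0, 1, 2] : Fin 3 → Fin 4) l))) (![m i + 2, 1, m i + 1]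 : Fin 3 → ℕ) (D * (p * (∏ j : Fin r, ((m j + 2) * (m j + 1))))) (y i j) (hy i j)) (algebraMap (Localization.Away (hh i)) ↥(cobordantAlgebra (fun l => algebraMap (MvPolynomial (Fin 4) k) (Localization.Away (hh i)) (X ((![0, 1, 2] : Fin 3 → Fin 4) l))) (![m i + 2, 1, m i + 1] : Fin 3 → ℕ)) (algebraMap (MvPolynomial (Fin 4) k) (Localization.Away (hh i)) (eI i t))) := by
    intro i j t
    letI := chartNodeGradedRing ![] (𝒜u i) (fun l => algebraMap (MvPolynomial (Fin 4) k) (Localization.Away (hh i)) (X ((![0, 1, 2] : Fin 3 → Fin 4) l))) (![m i + 2, 1, m i + 1] : Fin 3 → ℕ) (hfA i) (D * (p * (∏ j : Fin r, ((m j + 2) * (m j + 1))))) (y i j) (hy i j)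
    rw [← hresW, hpin i j (hWle₁ i j), toChartRing_apply]
    congr 2
    exact hpinW' i t
  obtain ⟨r0, hr0d⟩ : ∃ r0 : ∀ i, Γ(M₁.V, (OW i 1).1), r0 = fun i => π₁.appLE O.1 (OW i 1).1 (hO1 i 1) (e₀.symm (X 0)) := ⟨_, rfl⟩
  obtain ⟨r1, hr1d⟩ : ∃ r1 : ∀ i, Γ(M₁.V, (OW i 1).1), r1 = fun i => π₁.appLE O.1 (OW i 1).1 (hO1 i 1) (e₀.symm (X 1 - C (α i))) := ⟨_, rfl⟩
  obtain ⟨rt, hrtd⟩ : ∃ rt : ∀ i, Γ(M₁.V, (OW i 1).1), rt = fun i => π₁.appLE O.1 (OW i 1).1 (hO1 i 1) (e₀.symm tg) := ⟨_, rfl⟩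
  have hr0 : ∀ i, letI := chartNodeGradedRing ![] (𝒜u i) (fun l => algebraMap (MvPolynomial (Fin 4) k) (Localization.Away (hh i)) (X ((![0, 1, 2] : Fin 3 → Fin 4) l))) (![m i + 2, 1, m i + 1] : Fin 3 → ℕ) (hfA i) (D * (p * (∏ j : Fin r, ((m j + 2) * (m j + 1))))) (y i 1) (hy i 1)
      ((E i 1 (r0 i) : ↥((chartNodeGrading ![] (𝒜u i) (fun l => algebraMap (MvPolynomial (Fin 4) k) (Localization.Away (hh i)) (X ((![0, 1, 2] : Fin 3 → Fin 4) l))) (![m i + 2, 1, m i + 1] : Fin 3 → ℕ) (hfA i) (D * (p * (∏ j : Fin r, ((m j + 2) * (m j + 1))))) (y i 1) (hy i 1)) 0)) : (ChartRing (𝒜u i) (fun l => algebraMap (MvPolynomial (Fin 4) k) (Localization.Away (hh i)) (X ((![0, 1, 2] : Fin 3 → Fin 4) l))) (![m i + 2, 1, m i + 1] : Fin 3 → ℕ) (D * (p * (∏ j : Fin r, ((m j + 2) * (m j + 1))))) (y i 1) (hy i 1))) =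
        algebraMap ↥(cobordantAlgebra (fun l => algebraMap (MvPolynomial (Fin 4) k) (Localization.Away (hh i)) (X ((![0, 1, 2] : Fin 3 → Fin 4) l))) (![m i + 2, 1, m i + 1] : Fin 3 → ℕ)) (ChartRing (𝒜u i) (fun l => algebraMap (MvPolynomial (Fin 4) k) (Localization.Away (hh i)) (X ((![0, 1, 2] : Fin 3 → Fin 4) l))) (![m i + 2, 1, m i + 1] : Fin 3 → ℕ) (D * (p * (∏ j : Fin r, ((m j + 2) * (m j + 1))))) (y i 1) (hy i 1)) (algebraMap (Localization.Away (hh i)) ↥(cobordantAlgebra (fun l => algebraMap (MvPolynomial (Fin 4) k) (Localization.Away (hh i)) (X ((![0, 1, 2] : Fin 3 → Fin 4) l))) (![m i + 2, 1, m i + 1] : Fin 3 → ℕ)) ((fun l => algebraMap (MvPolynomial (Fin 4) k) (Localization.Away (hh i)) (X ((![0, 1, 2] : Fin 3 → Fin 4) l))) 0)) := fun i => by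
    rw [hr0d, hEval i 1, heI, e₀.apply_symm_apply, hγ0]
    rfl
  have hr1 : ∀ i, letI := chartNodeGradedRing ![] (𝒜u i) (fun l => algebraMap (MvPolynomial (Fin 4) k) (Localization.Away (hh i)) (X ((![0, 1, 2] : Fin 3 → Fin 4) l))) (![m i + 2, 1, m i + 1] : Fin 3 → ℕ) (hfA i) (D * (p * (∏ j : Fin r, ((m j + 2) * (m j + 1))))) (y i 1) (hy i 1)
      ((E i 1 (r1 i) : ↥((chartNodeGrading ![] (𝒜u i) (fun l => algebraMap (MvPolynomial (Fin 4) k) (Localization.Away (hh i)) (X ((![0, 1, 2] : Fin 3 → Fin 4) l))) (![m i + 2, 1, m i + 1] : Fin 3 → ℕ) (hfA i) (D * (p * (∏ j : Fin r, ((m j + 2) * (m j + 1))))) (y i 1) (hy i 1)) 0)) : (ChartRing (𝒜u i) (fun l => algebraMap (MvPolynomial (Fin 4) k) (Localization.Away (hh i)) (X ((![0, 1, 2] : Fin 3 → Fin 4) l))) (![m i + 2, 1, m i + 1] : Fin 3 → ℕ) (D * (p * (∏ j : Fin r, ((m j + 2) * (m j + 1))))) (y i 1) (hy i 1))) =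
        algebraMap ↥(cobordantAlgebra (fun l => algebraMap (MvPolynomial (Fin 4) k) (Localization.Away (hh i)) (X ((![0, 1, 2] : Fin 3 → Fin 4) l))) (![m i + 2, 1, m i + 1] : Fin 3 → ℕ)) (ChartRing (𝒜u i) (fun l => algebraMap (MvPolynomial (Fin 4) k) (Localization.Away (hh i)) (X ((![0, 1, 2] : Fin 3 → Fin 4) l))) (![m i + 2, 1, m i + 1] : Fin 3 → ℕ) (D * (p * (∏ j : Fin r, ((m j + 2) * (m j + 1))))) (y i 1) (hy i 1)) (algebraMap (Localization.Away (hh i)) ↥(cobordantAlgebra (fun l => algebraMap (MvPolynomial (Fin 4) k) (Localization.Away (hh i)) (X ((![0, 1, 2] : Fin 3 → Fin 4) l))) (![m i + 2, 1, m i + 1] : Fin 3 → ℕ)) ((fun l => algebraMap (MvPolynomial (Fin 4) k) (Localization.Away (hh i)) (X ((![0, 1, 2] : Fin 3 → Fin 4) l))) 1)) := fun i => by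
    rw [hr1d, hEval i 1, heI, e₀.apply_symm_apply, map_sub, hγ1, show γ i (C (α i)) = C (α i) from (γ i).commutes _, add_sub_cancel_right]
    rfl
  have hrt : ∀ i, letI := chartNodeGradedRing ![] (𝒜u i) (fun l => algebraMap (MvPolynomial (Fin 4) k) (Localization.Away (hh i)) (X ((![0, 1, 2] : Fin 3 → Fin 4) l))) (![m i + 2, 1, m i + 1] : Fin 3 → ℕ) (hfA i) (D * (p * (∏ j : Fin r, ((m j + 2) * (m j + 1))))) (y i 1) (hy i 1)
      ((E i 1 (rt i) : ↥((chartNodeGrading ![] (𝒜u i) (fun l => algebraMap (MvPolynomial (Fin 4) k) (Localization.Away (hh i)) (X ((![0, 1, 2] : Fin 3 → Fin 4) l))) (![m i + 2, 1, m i + 1] : Fin 3 → ℕ) (hfA i) (D * (p * (∏ j : Fin r, ((m j + 2) * (m j + 1))))) (y i 1) (hy i 1)) 0)) : (ChartRing (𝒜u i) (fun l => algebraMap (MvPolynomial (Fin 4) k) (Localization.Away (hh i)) (X ((![0, 1, 2] : Fin 3 → Fin 4) l))) (![m i + 2, 1, m i + 1] : Fin 3 → ℕ) (D * (p * (∏ j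 : Fin r, ((m j + 2) * (m j + 1))))) (y i 1) (hy i 1))) =
        algebraMap ↥(cobordantAlgebra (fun l => algebraMap (MvPolynomial (Fin 4) k) (Localization.Away (hh i)) (X ((![0, 1, 2] : Fin 3 → Fin 4) l))) (![m i + 2, 1, m i + 1] : Fin 3 → ℕ)) (ChartRing (𝒜u i) (fun l => algebraMap (MvPolynomial (Fin 4) k) (Localization.Away (hh i)) (X ((![0, 1, 2] : Fin 3 → Fin 4) l))) (![m i + 2, 1, m i + 1] : Fin 3 → ℕ) (D * (p * (∏ j : Fin r, ((m j + 2) * (m j + 1))))) (y i 1) (hy i 1)) (algebraMap (Localization.Away (hh i)) ↥(cobordantAlgebra (fun l => algebraMap (MvPolynomial (Fin 4) k) (Localization.Away (hh i)) (X ((![0, 1, 2] : Fin 3 → Fin 4) l))) (![m i + 2, 1, m i + 1] : Fin 3 → ℕ)) (algebraMap (MvPolynomial (Fin 4) k) (Localization.Away (hh i)) (X 2 - X 1 ^ (m i + 1) * Polynomial.aeval (X 1 : MvPolynomial (Fin 4) k) (wloc i) : MvPolynomial (Fin 4) k))) := fun i => by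
    rw [hrtd, hEval i 1, heI, e₀.apply_symm_apply, hγtg]
  -- ### the members on the charts `O′ᵢ₁`
  have hy2c : ∀ i, (coverElement (𝒜u i) (fun l => algebraMap (MvPolynomial (Fin 4) k) (Localization.Away (hh i)) (X ((![0, 1, 2] : Fin 3 → Fin 4) l))) (![m i + 2, 1, m i + 1] : Fin 3 → ℕ) (D * (p * (∏ j : Fin r, ((m j + 2) * (m j + 1)))))) (y i 2) (hy i 2) = (∏ j : ZMod p, (⇑(sigmaR (sigmaAway (σI i) (hσh i)) (fun l => algebraMap (MvPolynomial (Fin 4) k) (Localization.Away (hh i)) (X ((![0, 1, 2] : Fin 3 → Fin 4) l))) (![m i + 2, 1, m i + 1] : Fin 3 → ℕ) (hσJ i) hp.pos (hσpL i)))^[j.val] (⟨_, C_mul_T_mem_cobordantAlgebra _ _ (ht i)⟩ : ↥(cobordantAlgebra (fun l => algebraMap (MvPolynomial (Fin 4) k) (Localization.Away (hh i)) (X ((![0, 1, 2] : Fin 3 → Fin 4) l))) (![m i + 2, 1, m i + 1] : Fin 3 → ℕ)))) ^ (D * (m i + 2) * (∏ j ∈ Finset.univ.erase i, ((m j + 2)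 * (m j + 1)))) := fun i =>
    QhAbs.qha_coverElement_two_eq (sigmaAway (σI i) (hσh i)) (fun l => algebraMap (MvPolynomial (Fin 4) k) (Localization.Away (hh i)) (X ((![0, 1, 2] : Fin 3 → Fin 4) l))) (algebraMap (MvPolynomial (Fin 4) k) (Localization.Away (hh i)) (X 2 - X 1 ^ (m i + 1) * Polynomial.aeval (X 1 : MvPolynomial (Fin 4) k) (wloc i) : MvPolynomial (Fin 4) k)) (![m i + 2, 1, m i + 1] : Fin 3 → ℕ) (m i + 1) (ht i) (hσJ i) ![] (𝒜u i) (y i 2) (hy i 2) hp.pos (hσpL i) (D * (m i + 2) * (∏ j ∈ Finset.univ.erase i, ((m j + 2) * (m j + 1))))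
      (hd₂ i) (hy2 i)
  have hmem := fun i => exists_graphTail_memberChart (p := p) (σI i) (hCI i) (h0I i) (h1I i) (h2I i) (m i) (wloc i) (h3I i)
    (Finset.univ.erase i) (fun j => α i - α j) (hne i) m c hc (GraphTail.local_derivative_eq g α m c hg' i (wloc i) (hwloc i))
    (hh i) (hhh i) (hσh i) hp.pos (hσpL i) (hσJ i) (ht i) ![] (𝒜u i) (hfull0 i) (hfA i) (y i 1) (hy i 1) (hσy i 1) hn₁ (hc1 i)
    M₁ (OW i 1) (hOWaff i 1) (E i 1) (htame' i 1) (hE' i 1) (r0 i) (r1 i) (rt i) (tr i 1 0) (tr i 1 2) (hr0 i) (hr1 i) (hrt i) (hd₀ i)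
    (by rw [htrE i 1 0, hc0 i]) (hn₂ i) (hd₂ i) (by rw [htrE i 1 2, hy2c i])
  choose a b hrel_a hrel_b hbo0 hbo2 d₀ hd₀pos hKex using hmem
  obtain ⟨D', hD'def⟩ : ∃ D' : ℕ, D' = ∏ i, d₀ i := ⟨_, rfl⟩
  have hD'mul : ∀ i, d₀ i * ∏ j ∈ Finset.univ.erase i, d₀ j = D' := fun i => hD'def ▸ Finset.mul_prod_erase Finset.univ d₀ (Finset.mem_univ i)
  have hl'pos : ∀ i, 0 < ∏ j ∈ Finset.univ.erase i, d₀ j := fun i => Finset.prod_pos fun j _ => hd₀pos j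
  have hD' : 0 < D' := by rw [hD'def]; exact Finset.prod_pos fun j _ => hd₀pos j
  have hK := fun i => hKex i (∏ j ∈ Finset.univ.erase i, d₀ j) (hl'pos i)
  choose 𝒦₀ hprin hsec using hK
  have hprin' : ∀ i, IsPrincipalCentreChart p M₁.act g₀ (𝒦₀ i) D' (OW i 1) := fun i => hD'mul i ▸ hprin i
  -- ### units on the other producer charts (off the support) and on the overlaps
  have hnotsupp : ∀ i k', k' ≠ i → ∀ v : M₁.V, π₁.base v ∈ (basicOpenStable (GModel.initial (p := p) (g₀ := g₀) hq h₀).act O hO (actO_symm_eq_of_fixed hG (GModel.initial (p := p) (g₀ := g₀) hq h₀) O (eI i) (σI i) (hactI i) (hh i) (hσh i))).1 → π₁.base v ∈ (basicOpenStable (GModel.initial (p := p) (g₀ := g₀) hq h₀).act O hO (actO_symm_eq_of_fixed hG (GModel.initial (p := p) (g₀ := g₀) hq h₀) O (eI k') (σI k') (hactI k') (hh k') (hσh k'))).1 → π₁.base v ∉ ((((infRees 𝒦).ideal D ^ (p * (∏ j : Fin r, ((m j + 2) * (m j + 1))))).support : Set (GModel.initial (p := p) (g₀ := g₀) hq h₀).V))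 := by
    intro i k' hk v hvi hvk hvs
    rw [Scheme.IdealSheafData.support_pow _ _ hkk.ne'] at hvs
    obtain ⟨j, hj⟩ := Set.mem_iUnion.mp (MultiRoot.support_infRees_subset 𝒦 D hvs)
    by_cases hji : j = i
    · exact Set.disjoint_left.mp (hWoff k' i (Ne.symm hk)) hvk (hji ▸ hj)
    · exact Set.disjoint_left.mp (hWoff i j hji) hvi hj
  have hy0sec : ∀ i, (eW i).symm (y i 0) = (sW i (e₀.symm (X 0))) ^ (D * p * (m i + 1) * (∏ j ∈ Finset.univ.erase i, ((m j + 2) * (m j + 1)))) := fun i => (eW i).injective (Subtype.ext (by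
    rw [(eW i).apply_symm_apply, map_pow, SetLike.GradeZero.coe_pow, hpinW' i, heI, e₀.apply_symm_apply, hγ0, hy0 i]; rfl))
  choose F' hF' using fun i => GraphTail.dvd_prod_iterate_pow (p := p) (⇑(σI i)) (X 2 - X 1 ^ (m i + 1) * Polynomial.aeval (X 1 : MvPolynomial (Fin 4) k) (wloc i) : MvPolynomial (Fin 4) k) (hn₂ i)
  have hy2sec : ∀ i, (eW i).symm (y i 2) = sW i (e₀.symm tg) * sW i ((eI i).symm (F' i)) := fun i => (eW i).injective (Subtype.ext (by
    rw [(eW i).apply_symm_apply, map_mul, SetLike.GradeZero.coe_mul, hpinW' i, hpinW' i, (eI i).apply_symm_apply, ← heIT i, (eI i).apply_symm_apply, ← map_mul,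
      ← hF' i, hy2 i, map_pow, map_prod]
    exact congrArg (· ^ (D * (m i + 2) * (∏ j ∈ Finset.univ.erase i, ((m j + 2) * (m j + 1))))) (Finset.prod_congr rfl fun j _ => NodeAway.iterate_sigmaAway_algebraMap _ _ _ _ _)))
  have hBU0 : ∀ i k', k' ≠ i → ∀ v ∈ (OW i 1).1, v ∈ (OW k' 0).1 → π₁.base v ∈ (GModel.initial (p := p) (g₀ := g₀) hq h₀).V.basicOpen (e₀.symm (X 0)) := by
    intro i k' hk v hvi hvk
    have hv0 : v ∈ blowupChart π₁ ((infRees 𝒦).ideal D ^ (p * (∏ j : Fin r, ((m j + 2) * (m j + 1))))) ⟨(basicOpenStable (GModel.initial (p := p) (g₀ := g₀) hq h₀).act O hO (actO_symm_eq_of_fixed hG (GModel.initial (p := p) (g₀ := g₀) hq h₀) O (eI k') (σI k') (hactI k') (hh k') (hσh k'))).1, hWaff k'⟩ ((eW k').symm (y k' 0)) := (congrArg (fun U : M₁.V.Opens => v ∈ U) (hOWeq k' 0)).mp hvk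
    have h := mem_basicOpen_appLE_of_mem_blowupChart_of_not_mem_support π₁ ((infRees 𝒦).ideal D ^ (p * (∏ j : Fin r, ((m j + 2) * (m j + 1))))) ⟨(basicOpenStable (GModel.initial (p := p) (g₀ := g₀) hq h₀).act O hO (actO_symm_eq_of_fixed hG (GModel.initial (p := p) (g₀ := g₀) hq h₀) O (eI k') (σI k') (hactI k') (hh k') (hσh k'))).1, hWaff k'⟩ ((eW k').symm (y k' 0)) hv0
      (hnotsupp i k' hk v (hWle₁ i 1 hvi) (hWle₁ k' 0 hvk)) (hWle₁ k' 0) hvk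
    rw [Scheme.basicOpen_appLE, hy0sec k', Scheme.basicOpen_pow _ _ (hn₀ k'), hsecres k'] at h
    exact h.2.2
  have hBU2 : ∀ i k', k' ≠ i → ∀ v ∈ (OW i 1).1, v ∈ (OW k' 2).1 → π₁.base v ∈ (GModel.initial (p := p) (g₀ := g₀) hq h₀).V.basicOpen (e₀.symm tg) := by
    intro i k' hk v hvi hvk
    have hv0 : v ∈ blowupChart π₁ ((infRees 𝒦).ideal D ^ (p * (∏ j : Fin r, ((m j + 2) * (m j + 1))))) ⟨(basicOpenStable (GModel.initial (p := p) (g₀ := g₀) hq h₀).act O hO (actO_symm_eq_of_fixed hG (GModel.initial (p := p) (g₀ := g₀) hq h₀) O (eI k') (σI k') (hactI k') (hh k') (hσh k'))).1, hWaff k'⟩ ((eW k').symm (y k' 2)) := (congrArg (fun U : M₁.V.Opens => v ∈ U) (hOWeq k' 2)).mp hvk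
    have h := mem_basicOpen_appLE_of_mem_blowupChart_of_not_mem_support π₁ ((infRees 𝒦).ideal D ^ (p * (∏ j : Fin r, ((m j + 2) * (m j + 1))))) ⟨(basicOpenStable (GModel.initial (p := p) (g₀ := g₀) hq h₀).act O hO (actO_symm_eq_of_fixed hG (GModel.initial (p := p) (g₀ := g₀) hq h₀) O (eI k') (σI k') (hactI k') (hh k') (hσh k'))).1, hWaff k'⟩ ((eW k').symm (y k' 2)) hv0
      (hnotsupp i k' hk v (hWle₁ i 1 hvi) (hWle₁ k' 2 hvk)) (hWle₁ k' 2) hvk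
    rw [Scheme.basicOpen_appLE, hy2sec k', Scheme.basicOpen_mul, hsecres k'] at h
    exact h.2.1.2
  have hbo_r0 : ∀ i, ∀ v ∈ (OW i 1).1, π₁.base v ∈ (GModel.initial (p := p) (g₀ := g₀) hq h₀).V.basicOpen (e₀.symm (X 0)) → v ∈ M₁.V.basicOpen (a i) := fun i v hv hπv => by
    have h1 : v ∈ M₁.V.basicOpen (r0 i) := by rw [hr0d, Scheme.basicOpen_appLE]; exact ⟨hv, hπv⟩
    rw [← hrel_a i, Scheme.basicOpen_mul] at h1; exact h1.1
  have hbo_rt : ∀ i, ∀ v ∈ (OW i 1).1, π₁.base v ∈ (GModel.initial (p := p) (g₀ := g₀) hq h₀).V.basicOpen (e₀.symm tg) → v ∈ M₁.V.basicOpen (b i) := fun i v hv hπv => by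
    have h1 : v ∈ M₁.V.basicOpen (rt i) := by rw [hrtd, Scheme.basicOpen_appLE]; exact ⟨hv, hπv⟩
    rw [← hrel_b i, Scheme.basicOpen_mul] at h1; exact h1.1
  have hbo_r1 : ∀ i j, i ≠ j → ∀ v ∈ (OW i 1).1, v ∈ (OW j 1).1 → v ∈ M₁.V.basicOpen (r1 i) := fun i j hij v hvi hvj => by
    have h := hWle i j hij (hWle₁ j 1 hvj)
    rw [heIs i, hγs1] at h
    rw [hr1d, Scheme.basicOpen_appLE]; exact ⟨hvi, h⟩
  -- ### MOVE 2: glue the members and kill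
  have htop : (⊤ : M₁.V.Opens) ≤ π₁ ⁻¹ᵁ O.1 := fun _ _ => Set.mem_univ _
  have happ : ∀ i (x : Γ((GModel.initial (p := p) (g₀ := g₀) hq h₀).V, O.1)), (M₁.V.presheaf.map (homOfLE (le_top : (OW i 1).1 ≤ ⊤)).op).hom (π₁.appLE O.1 ⊤ htop x) = π₁.appLE O.1 (OW i 1).1 (hO1 i 1) x :=
    fun i x => Scheme.Hom.appLE_map_apply π₁ htop (le_top : (OW i 1).1 ≤ ⊤) x
  refine killsIn_one_of_sectionCharts hp hG φ M₁ 𝔄₁ (fun i => OW i 1) 𝒦₀ hD' hprin' ![2, 1] (fun l => by fin_cases l <;> norm_num) (fun i => ![a i, b i]) hsec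
    ![π₁.appLE O.1 ⊤ htop (e₀.symm (X 0)), π₁.appLE O.1 ⊤ htop (e₀.symm tg)] (fun i => ![r1 i ^ (m i + 2), r1 i ^ (m i + 1)]) ?_ ?_
    (A := (Fin r ⊕ Fin r) ⊕ Unit)
    (fun a' => a'.elim (fun kk => kk.elim (fun k' => (OW k' 0).1) (fun k' => (OW k' 2).1)) (fun _ => π₁ ⁻¹ᵁ (GModel.initial (p := p) (g₀ := g₀) hq h₀).V.basicOpen (e₀.symm (X 0)))) ?_ ?_ hF₁W
  · intro i l
    fin_cases l
    · change a i * r1 i ^ (m i + 2) = (M₁.V.presheaf.map (homOfLE le_top).op).hom (π₁.appLE O.1 ⊤ htop (e₀.symm (X 0))); rw [hrel_a i, happ, hr0d]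
    · change b i * r1 i ^ (m i + 1) = (M₁.V.presheaf.map (homOfLE le_top).op).hom (π₁.appLE O.1 ⊤ htop (e₀.symm tg)); rw [hrel_b i, happ, hrtd]
  · intro i j hij l v hvi hvj
    fin_cases l
    · change v ∈ M₁.V.basicOpen (r1 i ^ (m i + 2)); rw [Scheme.basicOpen_pow _ _ (Nat.succ_pos _)]; exact hbo_r1 i j hij v hvi hvj
    · change v ∈ M₁.V.basicOpen (r1 i ^ (m i + 1)); rw [Scheme.basicOpen_pow _ _ (Nat.succ_pos _)]; exact hbo_r1 i j hij v hvi hvj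
  · intro x
    rcases hcovX (π₁.base x) with h | ⟨i, hi⟩
    · exact Or.inr ⟨Sum.inr (), h⟩
    · obtain ⟨j, hj⟩ := hcovM x i hi
      revert hj
      refine Fin.cases ?_ (Fin.cases ?_ (Fin.cases ?_ (fun l => l.elim0))) j
      · intro hj; exact Or.inr ⟨Sum.inl (Sum.inl i), hj⟩
      · intro hj; exact Or.inl (Set.mem_iUnion.mpr ⟨i, hj⟩)
      · intro hj; exact Or.inr ⟨Sum.inl (Sum.inr i), hj⟩
  · intro a' i
    rcases a' with ((k' | k') | u)
    · refine ⟨0, fun v hv hvk => ?_⟩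
      change v ∈ M₁.V.basicOpen (a i)
      by_cases hk : k' = i
      · subst hk; exact hbo0 _ v hv (htrU _ 1 0 v hv hvk)
      · exact hbo_r0 i v hv (hBU0 i k' hk v hv hvk)
    · refine ⟨1, fun v hv hvk => ?_⟩
      change v ∈ M₁.V.basicOpen (b i)
      by_cases hk : k' = i
      · subst hk; exact hbo2 _ v hv (htrU _ 1 2 v hv hvk)
      · exact hbo_rt i v hv (hBU2 i k' hk v hv hvk)
    · exact ⟨0, fun v hv hvu => hbo_r0 i v hv hvu⟩

end Summit.ResolutionOfSingularities.ResolutionOfSingularities.Theorems.WildQuotientResolution.S1.GameFrame.GModel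

end
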